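import Mathlib.MeasureTheory.Integral.Lebesgue.Basic
import Mathlib.MeasureTheory.Measure.OpenPos
import Mathlib.Analysis.SpecialFunctions.Pow.Continuity
import Mathlib.Topology.Algebra.Order.Field
import HarnessLib

/-!
# A sup bound from `Lᵖ` bounds as `p → ∞`

Analysis/FunctionSpaces proof file (one theorem; no definitions, no named facts). The elementary
half of the classical fact `‖f‖_{L^∞} = lim_{p→∞} ‖f‖_{L^p}` (for `f` in some `L^{p₀}`), in the form
in which it closes Nash/Moser iterations: if `∫ ‖f‖^{p_k} dμ ≤ B_k^{p_k}` along exponents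
`p_k → ∞` with `B_k → L`, then `‖f(x)‖ ≤ L` at every point, for `f` continuous and `μ` positive on
open sets. Source of the printed use: the last step of the Nash iteration of

> H. Feng, V. Šverák, *On the Cauchy problem for axi-symmetric vortex rings*, Arch. Ration. Mech.
> Anal. 215 (2015) 89–123 = arXiv:1301.6317, proof of Lemma 3.8 (arXiv p. 12): "`C_p = … ≤ … =:
> C_∞` ⟹ `‖η(t)‖_{L^∞_x} ≤ C_∞ t^{−3/2}`"

(= Gallay–Šverák 2015, Lemma 5.2 at `p = ∞`, an input of their (1.11)).

* `norm_le_of_lintegral_rpow_le_of_tendsto` — `μ` an `IsOpenPosMeasure` on a topological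
  measurable space, `f` continuous with values in a normed group, `0 < p_k → ∞`,
  `0 ≤ B_k → L`, `∫⁻ ‖f‖ₑ^{p_k} ≤ ofReal (B_k^{p_k})` for all `k` ⟹ `‖f x‖ ≤ L` for all `x`.
  Proof: if `‖f(x)‖ > c > L`, the open set `U = {‖f‖ > c} ∋ x` has `μ(U) > 0`, and
  `c^{p_k} μ(U) ≤ B_k^{p_k}`; `μ(U) = ∞` is absurd, else `c μ(U)^{1/p_k} ≤ B_k` with
  `μ(U)^{1/p_k} → 1`, so `c ≤ L`.

## Mathlib / tree search

`lean search 'eLpNormEssSup.*liminf|limsup.*eLpNorm.*top|tendsto_eLpNorm.*top|L∞.*lim.*Lp'`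
(2026-08-27): neither Mathlib (this pin) nor the tree states `‖f‖_∞ = lim_p ‖f‖_p` or this
corollary. Mathlib (used): `IsOpen.measure_pos`, `setLIntegral_const`, `setLIntegral_mono'`,
`ENNReal.ofReal_rpow_of_nonneg`, `Real.rpow_rpow_inv`, `Real.continuousAt_const_rpow`,
`Filter.Tendsto.div_atTop`, `le_of_tendsto_of_tendsto'`, `ge_of_tendsto'`.

## References

* H. Feng, V. Šverák, Arch. Ration. Mech. Anal. 215 (2015) = arXiv:1301.6317, proof of Lemma 3.8.
  [FengSverak2015]
* (textbook form) G. B. Folland, *Real Analysis*, 2nd ed., Wiley 1999, §6.1 Exercise 7: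
  "`‖f‖_∞ = lim_{q→∞} ‖f‖_q`" for `f ∈ L^p ∩ L^∞`.
-/

noncomputable section

open MeasureTheory Set Filter
open _root_.Topology
open scoped ENNReal NNReal

namespace Literature.Analysis.FunctionSpaces

/-- **Passage to `p = ∞` in a family of `Lᵖ` bounds.** Let `μ` be a measure positive on open
sets, `f` continuous, and suppose `∫ ‖f‖^{p_k} dμ ≤ B_k^{p_k}` along a sequence of exponents
`p_k → ∞` (`p_k > 0`) with `0 ≤ B_k → L`. Then `‖f(x)‖ ≤ L` for EVERY `x`: otherwise `‖f‖ > c > L`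
on an open set `U ∋ x` of positive measure, and `‖f‖_{p_k} ≥ c μ(U)^{1/p_k} → c` — the
elementary half of `lim_{p→∞} ‖f‖_p = ‖f‖_∞`, in the form used at the end of Nash iterations
(Feng–Šverák, proof of Lemma 3.8: "`C_p ≤ … =: C_∞` ⟹ `‖η(t)‖_{L^∞} ≤ C_∞ t^{−3/2}`").
[cite: FengSverak2015, proof of Lemma 3.8, last display before Remark 3.9 (arXiv:1301.6317 p. 12)] -/
theorem norm_le_of_lintegral_rpow_le_of_tendsto {X F : Type*} [MeasurableSpace X]
    [TopologicalSpace X] [OpensMeasurableSpace X] {μ : Measure X} [μ.IsOpenPosMeasure]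
    [NormedAddCommGroup F] {f : X → F} (hf : Continuous f) {p B : ℕ → ℝ} {L : ℝ}
    (hp0 : ∀ k, 0 < p k) (hp : Tendsto p atTop atTop) (hB0 : ∀ k, 0 ≤ B k)
    (hB : Tendsto B atTop (𝓝 L))
    (hbound : ∀ k, ∫⁻ x, ‖f x‖ₑ ^ (p k) ∂μ ≤ ENNReal.ofReal (B k ^ (p k))) (x : X) :
    ‖f x‖ ≤ L := by
  have hL0 : 0 ≤ L := ge_of_tendsto' hB hB0
  by_contra hlt
  push Not at hlt
  -- a level `c` strictly between `L` and `‖f x‖`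
  set c : ℝ := (L + ‖f x‖) / 2 with hc
  have hLc : L < c := by rw [hc]; linarith
  have hcf : c < ‖f x‖ := by rw [hc]; linarith
  have hc0 : 0 < c := hL0.trans_lt hLc
  -- the open set `U = {‖f‖ > c}` has positive measure
  set U : Set X := {y | c < ‖f y‖} with hU
  have hUo : IsOpen U := isOpen_lt continuous_const hf.norm
  have hxU : x ∈ U := hcf
  have hμU : 0 < μ U := hUo.measure_pos μ ⟨x, hxU⟩
  -- `c^{p_k} μ(U) ≤ B_k^{p_k}`
  have hlow : ∀ k, ENNReal.ofReal (c ^ p k) * μ U ≤ ENNReal.ofReal (B k ^ p k) := by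
    intro k
    calc ENNReal.ofReal (c ^ p k) * μ U = ∫⁻ _ in U, ENNReal.ofReal (c ^ p k) ∂μ :=
          (setLIntegral_const _ _).symm
      _ ≤ ∫⁻ y in U, ‖f y‖ₑ ^ p k ∂μ := by
          refine setLIntegral_mono' hUo.measurableSet fun y hy => ?_
          rw [← ofReal_norm, ENNReal.ofReal_rpow_of_nonneg (norm_nonneg _) (hp0 k).le]
          exact ENNReal.ofReal_le_ofReal (Real.rpow_le_rpow hc0.le (le_of_lt hy) (hp0 k).le)
      _ ≤ ∫⁻ y, ‖f y‖ₑ ^ p k ∂μ := setLIntegral_le_lintegral _ _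
      _ ≤ ENNReal.ofReal (B k ^ p k) := hbound k
  rcases eq_or_ne (μ U) ∞ with htop | hne
  · -- infinite measure: the left side is `∞`
    have h := hlow 0
    rw [htop, ENNReal.mul_top
      (ENNReal.ofReal_pos.2 (Real.rpow_pos_of_pos hc0 _)).ne'] at h
    exact absurd h (by simp)
  · set m : ℝ := (μ U).toReal with hm
    have hm0 : 0 < m := ENNReal.toReal_pos hμU.ne' hne
    -- `c · m^{1/p_k} ≤ B_k`
    have hk : ∀ k, c * m ^ (1 / p k) ≤ B k := by
      intro k
      have h1 : c ^ p k * m ≤ B k ^ p k := by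
        have h := hlow k
        rw [← ENNReal.ofReal_toReal hne, ← hm,
          ← ENNReal.ofReal_mul (Real.rpow_nonneg hc0.le _)] at h
        exact (ENNReal.ofReal_le_ofReal_iff (Real.rpow_nonneg (hB0 k) _)).1 h
      have h2 := Real.rpow_le_rpow (mul_nonneg (Real.rpow_nonneg hc0.le _) hm0.le) h1
        (div_nonneg zero_le_one (hp0 k).le)
      rw [Real.mul_rpow (Real.rpow_nonneg hc0.le _) hm0.le, one_div, Real.rpow_rpow_inv hc0.le (hp0 k).ne',
        Real.rpow_rpow_inv (hB0 k) (hp0 k).ne'] at h2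
      rwa [one_div]
    -- `m^{1/p_k} → 1`
    have hlim : Tendsto (fun k => c * m ^ (1 / p k)) atTop (𝓝 c) := by
      have h1 : Tendsto (fun k => 1 / p k) atTop (𝓝 0) := tendsto_const_nhds.div_atTop hp
      have h2 : Tendsto (fun k => m ^ (1 / p k)) atTop (𝓝 (m ^ (0 : ℝ))) :=
        ((Real.continuousAt_const_rpow hm0.ne').tendsto).comp h1
      rw [Real.rpow_zero] at h2
      simpa using h2.const_mul c
    have : c ≤ L := le_of_tendsto_of_tendsto' hlim hB hk
    linarith

end Literature.Analysis.FunctionSpaces
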